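import Literature.NumberTheory.Sieve.CircleMethodMajorArcsProofs
import Literature.NumberTheory.LFunctions.SiegelWalfisz
import HarnessLib

/-!
# MRT Proposition 4.1 (the prime exponential sum on a major arc), unconditionally

Topic `Literature/NumberTheory/Sieve`; third layer over the named fact
`Literature.NumberTheory.Sieve.MatomakiRadziwillTao2019_prop41` (`CircleMethodMajorArcs.lean`;
Matomäki–Radziwiłł–Tao, Proc. LMS 118 (2019), Proposition 4.1, arXiv:1707.01315 p. 20:

> *Let `A, B, B' > 0`, `X ≥ 2`, and let `α = a/q + β` for some `1 ≤ q ≤ log^B X`, `(a,q) = 1`,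
> and `|β| ≤ log^{B'} X / X`. Then we have
> `S_{Λ1_{[1,X]}}(α) = (μ(q)/φ(q)) ∫_1^X e(βx) dx + O_{A,B,B'}(X log^{-A} X)`.*
> *Proof.* See [Nathanson]. We remark that this estimate requires Siegel's theorem and so the
> bounds are ineffective.)

Everything here is PROVED, and this file only composes two results of the tree:

* `CircleMethodMajorArcsProofs.lean` proves the printed reduction to the Siegel–Walfisz theorem,
  `Literature.NumberTheory.Sieve.MatomakiRadziwillTao2019_prop41_of_siegelWalfisz :
  Literature.NumberTheory.Sieve.siegel_walfisz → MatomakiRadziwillTao2019_prop41`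
  (Nathanson, GTM 164, Lemmas 8.2–8.3, the `[nathanson]` of MRT's proof);
* `Literature/NumberTheory/LFunctions/SiegelWalfisz.lean` proves the Siegel–Walfisz theorem
  `Literature.NumberTheory.LFunctions.siegel_walfisz_holds` (parity.S28; Walfisz 1936,
  Montgomery–Vaughan Cor. 11.19, via the zero-free region for Dirichlet `L`-functions, Siegel's
  theorem and Landau's explicit `ψ`-estimate).

Hence the discharge

  `theorem MatomakiRadziwillTao2019_prop41_holds : MatomakiRadziwillTao2019_prop41`.

The composition is kept in this separate file (exactly as for Prop. 3.3(i) in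
`CircleMethodMajorArcsPrimePairUnconditional.lean`) so that the statement file
`CircleMethodMajorArcs.lean` keeps its light imports and the circle-method proof files
(`CircleMethodMajorArcsProofs.lean` and its dependants) do not import the `L`-function theory
behind `siegel_walfisz_holds`. No definitions; the constant is ineffective (Siegel), as MRT remark.

## References

* K. Matomäki, M. Radziwiłł, T. Tao, *Correlations of the von Mangoldt and higher divisor
  functions I. Long shift ranges*, Proc. LMS 118 (2019) 284–350, arXiv:1707.01315, Prop. 4.1
  (p. 20 of the held arXiv text, `lit read arxiv:1707.01315 --pages 20`). [MatomakiRadziwillTao2019]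
* M. B. Nathanson, *Additive Number Theory: The Classical Bases*, GTM 164 (Springer, 1996),
  Lemmas 8.2–8.3. [Nathanson1996]
* A. Walfisz, *Zur additiven Zahlentheorie. II*, Math. Z. 40 (1936), 592–607. [Walfisz1936]
* H. L. Montgomery, R. C. Vaughan, *Multiplicative Number Theory I*, CUP 2007, Cor. 11.19.
  [MontgomeryVaughan2007]
-/

noncomputable section

namespace Literature.NumberTheory.Sieve

/-- **Matomäki–Radziwiłł–Tao 2019, Proposition 4.1, PROVED** (prime exponential sum on a major
arc: for `A, B, B' > 0` there is `C` such that for all `X ≥ 2`, `1 ≤ q ≤ log^B X`, `(a, q) = 1`,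
`|β| ≤ log^{B'} X / X`,
`‖S_{Λ1_{[1,X]}}(a/q + β) − (μ(q)/φ(q)) ∫_1^X e(βx) dx‖ ≤ C X log^{-A} X`, recorded for `X : ℕ` with
`S_{Λ1_{[1,X]}} = Literature.NumberTheory.Sieve.primeExpSum X`): MRT's printed proof ("See
[Nathanson]", `MatomakiRadziwillTao2019_prop41_of_siegelWalfisz`) composed with the tree's
Siegel–Walfisz theorem `Literature.NumberTheory.LFunctions.siegel_walfisz_holds`. Ineffective
(Siegel). [cite: MatomakiRadziwillTao2019, Prop. 4.1, p. 20 (arXiv)] -/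
theorem MatomakiRadziwillTao2019_prop41_holds : MatomakiRadziwillTao2019_prop41 :=
  MatomakiRadziwillTao2019_prop41_of_siegelWalfisz LFunctions.siegel_walfisz_holds

end Literature.NumberTheory.Sieve

end
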